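import Literature.Analysis.Calculus.CornerClassEmbedding          -- ★ p852090 (this seat): `cexp_two_mul_arctan_mul_I`, `cexp_add_mul_I`, `conj_cexp_mul_cexp`, `hasFDerivAt_div_of_eq_one`
import Literature.Analysis.Calculus.NewtonSymmetricTwo            -- ★ `exists_contDiff_comp_esymm_two_of_swap` (smooth Newton theorem, two variables, parameters)
import HarnessLib

/-!
# The WALL CLASS EMBEDDING: near a wall point `(ζ, ζ, ξ)` (`ξ ≠ ζ`) of the torus `(S¹)³`, a smooth germ symmetric under the swap of the two coincident slots is a smooth function of the
# COMPLEX class data — explicit rational∕trigonometric chart, its rank, the smooth left inverse (Glaeser 1963 `n = 2`; Schwarz 1975; folklore IFT)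

Topic `Analysis/Calculus`; namespace `Literature.Analysis.Calculus`.  THEOREMS ONLY (no `def`, no instance, no notation, no axiom, no named fact, no `sorry`); Mathlib + ★ `CornerClassEmbedding`
(p852090) + ★ `NewtonSymmetricTwo`; NO `Rogawski1990` import.  Cell `pub/hodgecm-mathlib`, crux H413 (`stmt-HodgeConjecture-24833`), road «N8-INNER» ROAD B, brick (GT) «Glaeser on the torus
with parameters» (dealer LH2-plan (g1) → LH10-p02 (g9)): the SECOND of the three local models (corner ★ p852090 ∕ WALL here ∕ regular).  Count-neutral.

THE MATHEMATICS.  At a wall base point `λ⁰ = (e^{iθ₀}, e^{iθ₀}, e^{iφ₀})` with `e^{iφ₀} ≠ e^{iθ₀}` the stabiliser in `S₃` is the swap of the slots `0, 1`.  A smooth germ `g(x, z)` in the angle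
offsets, invariant under that swap, is — in the rational chart `x_k = 2 arctan t_k` (`k = 0, 1`), third offset `y = x₂` kept — a smooth function `G(s, p, y, z)` of `s = t₀ + t₁`, `p = t₀t₁`
(★ Newton-`S₂`).  The class data `σ(x) = (Σ λ_k, Σ λ_jλ_k, Π λ_k)`, `λ_k = λ⁰_k e^{ix_k}`, read through the three real functionals `(Re ζ̄σ₁, Im ζ̄σ₁, Im ζ̄²ξ̄σ₃)` are the EXPLICIT functions
`ψ(s,p,y) = (2(1−p²)∕D + c cos y − d sin y, 2s(1+p)∕D + d cos y + c sin y, (2s(1−p) cos y + ((1−p)² − s²) sin y)∕D)`, `D = (1−p)² + s²`, `c + id = ξ ζ̄`, whose Jacobian at `0` is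
`[[0, 4, −d], [2, 0, c], [2, 0, 1]]` with determinant `−8(1 − c) ≠ 0` exactly because `ξ ≠ ζ`.  Smooth IFT ⇒ a smooth left inverse `π` of the class map on an open `W ∋ σ⁰`; `F := G ∘ (π × id)`.
* §1 `re_eq_one_of_norm_eq_one` bookkeeping, the two-slot rational identities `sum_cos_chart_two_eq`, `sum_sin_chart_two_eq`, `prod_chart_two_re∕_im`;
* §2 `hasFDerivAt_wallChart_zero` (the Jacobian), `exists_continuousLinearEquiv_wallChart` (its inverse, needs `c ≠ 1`);
* §3 **`exists_contDiffOn_comp_wallClass_of_swap`** — the wall local model: `∃ W ∋ σ⁰` open, `F` smooth on `W × P`, `δ > 0`: `‖x‖ < δ ⇒ σ(x) ∈ W ∧ F (σ x, z) = g (x, z)`.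
HONEST LABEL: calculus plumbing; HC_CM is proved only modulo the 7 printed citations (2 remaining: hLiu418 = stmt-HodgeConjecture-24832, h413 = stmt-HodgeConjecture-24833) until rung 0 closes.

## References
* [Glaeser1963Newton] G. Glaeser, *Fonctions composées différentiables*, Ann. of Math. 77 (1963) 193–209, Thm. II (`n = 2`).
* [Schwarz1975] G. W. Schwarz, *Smooth functions invariant under the action of a compact Lie group*, Topology 14 (1975) 63–68, Thm. 1.
* [Dieudonne1960] J. Dieudonné, *Foundations of Modern Analysis* (1960), Ch. X §2.
-/

set_option autoImplicit false

noncomputable section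

open Complex Set Function Filter Topology Metric Real
open scoped ContDiff

namespace Literature.Analysis.Calculus

/-! ## §1 Bookkeeping and the two-slot rational identities -/

/-- A unit complex number with real part `1` is `1`; contrapositive reading: `ξ ζ̄ ≠ 1 ⇒ Re(ξ ζ̄) ≠ 1` for unit `ξ ζ̄`. [cite: Dieudonne1960, Ch. X §2] -/
theorem re_ne_one_of_ne_one_of_norm_eq_one {w : ℂ} (hw : ‖w‖ = 1) (hne : w ≠ 1) : w.re ≠ 1 := by
  intro hre
  apply hne
  have hsq : w.re * w.re + w.im * w.im = 1 := by
    have := Complex.normSq_eq_norm_sq w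
    rw [Complex.normSq_apply, hw] at this
    linarith
  have him : w.im = 0 := by nlinarith
  exact Complex.ext (by simp [hre]) (by simp [him])

/-- `Σ_{k<2} (1 − t_k²)∕(1 + t_k²) = 2(1 − p²)∕((1 − p)² + s²)`, `s = t₀ + t₁`, `p = t₀t₁`. [cite: Glaeser1963Newton, Thm. II] -/
theorem sum_cos_chart_two_eq (t₀ t₁ : ℝ) :
    (1 - t₀ ^ 2) / (1 + t₀ ^ 2) + (1 - t₁ ^ 2) / (1 + t₁ ^ 2) = 2 * (1 - (t₀ * t₁) ^ 2) / ((1 - t₀ * t₁) ^ 2 + (t₀ + t₁) ^ 2) := by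
  have h0 : (1 : ℝ) + t₀ ^ 2 ≠ 0 := by positivity
  have h1 : (1 : ℝ) + t₁ ^ 2 ≠ 0 := by positivity
  have hD : (1 - t₀ * t₁) ^ 2 + (t₀ + t₁) ^ 2 = (1 + t₀ ^ 2) * (1 + t₁ ^ 2) := by ring
  rw [hD, div_add_div _ _ h0 h1]
  congr 1
  ring

/-- `Σ_{k<2} 2t_k∕(1 + t_k²) = 2s(1 + p)∕((1 − p)² + s²)`. [cite: Glaeser1963Newton, Thm. II] -/
theorem sum_sin_chart_two_eq (t₀ t₁ : ℝ) :
    2 * t₀ / (1 + t₀ ^ 2) + 2 * t₁ / (1 + t₁ ^ 2) = 2 * (t₀ + t₁) * (1 + t₀ * t₁) / ((1 - t₀ * t₁) ^ 2 + (t₀ + t₁) ^ 2) := by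
  have h0 : (1 : ℝ) + t₀ ^ 2 ≠ 0 := by positivity
  have h1 : (1 : ℝ) + t₁ ^ 2 ≠ 0 := by positivity
  have hD : (1 - t₀ * t₁) ^ 2 + (t₀ + t₁) ^ 2 = (1 + t₀ ^ 2) * (1 + t₁ ^ 2) := by ring
  rw [hD, div_add_div _ _ h0 h1]
  congr 1
  ring

/-- Real part of the two-slot chart product: `((1−p)² − s²)∕D`. [cite: Glaeser1963Newton, Thm. II] -/
theorem prod_chart_two_re (t₀ t₁ : ℝ) :
    ((((((1 - t₀ ^ 2) / (1 + t₀ ^ 2) : ℝ)) : ℂ) + ((((2 * t₀ / (1 + t₀ ^ 2) : ℝ)) : ℂ)) * I) *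
        (((((1 - t₁ ^ 2) / (1 + t₁ ^ 2) : ℝ)) : ℂ) + ((((2 * t₁ / (1 + t₁ ^ 2) : ℝ)) : ℂ)) * I)).re =
      ((1 - t₀ * t₁) ^ 2 - (t₀ + t₁) ^ 2) / ((1 - t₀ * t₁) ^ 2 + (t₀ + t₁) ^ 2) := by
  have h0 : (1 : ℝ) + t₀ ^ 2 ≠ 0 := by positivity
  have h1 : (1 : ℝ) + t₁ ^ 2 ≠ 0 := by positivity
  have hD : (1 - t₀ * t₁) ^ 2 + (t₀ + t₁) ^ 2 = (1 + t₀ ^ 2) * (1 + t₁ ^ 2) := by ring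
  simp only [Complex.mul_re, Complex.add_re, Complex.add_im, Complex.ofReal_re, Complex.ofReal_im, Complex.mul_im, Complex.I_re, Complex.I_im,
    mul_zero, sub_zero, add_zero, zero_add, mul_one]
  rw [hD]
  field_simp
  ring

/-- Imaginary part of the two-slot chart product: `2s(1−p)∕D`. [cite: Glaeser1963Newton, Thm. II] -/
theorem prod_chart_two_im (t₀ t₁ : ℝ) :
    ((((((1 - t₀ ^ 2) / (1 + t₀ ^ 2) : ℝ)) : ℂ) + ((((2 * t₀ / (1 + t₀ ^ 2) : ℝ)) : ℂ)) * I) *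
        (((((1 - t₁ ^ 2) / (1 + t₁ ^ 2) : ℝ)) : ℂ) + ((((2 * t₁ / (1 + t₁ ^ 2) : ℝ)) : ℂ)) * I)).im =
      2 * (t₀ + t₁) * (1 - t₀ * t₁) / ((1 - t₀ * t₁) ^ 2 + (t₀ + t₁) ^ 2) := by
  have h0 : (1 : ℝ) + t₀ ^ 2 ≠ 0 := by positivity
  have h1 : (1 : ℝ) + t₁ ^ 2 ≠ 0 := by positivity
  have hD : (1 - t₀ * t₁) ^ 2 + (t₀ + t₁) ^ 2 = (1 + t₀ ^ 2) * (1 + t₁ ^ 2) := by ring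
  simp only [Complex.mul_re, Complex.add_re, Complex.add_im, Complex.ofReal_re, Complex.ofReal_im, Complex.mul_im, Complex.I_re, Complex.I_im,
    mul_zero, sub_zero, add_zero, zero_add, mul_one]
  rw [hD]
  field_simp
  ring

/-- `Re` and `Im` of `w · e^{iy}` for a complex constant `w`. [cite: Dieudonne1960, Ch. VIII §2] -/
theorem re_mul_cexp_mul_I (w : ℂ) (y : ℝ) : (w * Complex.exp ((y : ℂ) * I)).re = w.re * Real.cos y - w.im * Real.sin y := by
  rw [Complex.exp_mul_I]
  simp [Complex.mul_re, Complex.cos_ofReal_re, Complex.sin_ofReal_re, Complex.cos_ofReal_im, Complex.sin_ofReal_im]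

/-- `Im (w · e^{iy}) = Im w · cos y + Re w · sin y`. [cite: Dieudonne1960, Ch. VIII §2] -/
theorem im_mul_cexp_mul_I (w : ℂ) (y : ℝ) : (w * Complex.exp ((y : ℂ) * I)).im = w.im * Real.cos y + w.re * Real.sin y := by
  rw [Complex.exp_mul_I]
  simp [Complex.mul_im, Complex.cos_ofReal_re, Complex.sin_ofReal_re, Complex.cos_ofReal_im, Complex.sin_ofReal_im]
  ring

/-! ## §2 The Jacobian of the wall chart at `0` and its inverse -/

/-- **THE JACOBIAN OF THE WALL CHART AT `0`**: for real constants `c, d`, the map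
`ψ(e) = (2(1−e₁²)∕D + c cos e₂ − d sin e₂, 2e₀(1+e₁)∕D + d cos e₂ + c sin e₂, (2e₀(1−e₁) cos e₂ + ((1−e₁)²−e₀²) sin e₂)∕D)`, `D = (1−e₁)² + e₀²` (slots `e = (s, p, y)`), has derivative
`v ↦ (4v₁ − d v₂, 2v₀ + c v₂, 2v₀ + v₂)` at `0`. [cite: Dieudonne1960, Ch. VIII §2] -/
theorem hasFDerivAt_wallChart_zero (c d : ℝ) :
    HasFDerivAt (fun e : Fin 3 → ℝ => (![2 * (1 - e 1 ^ 2) / ((1 - e 1) ^ 2 + e 0 ^ 2) + (c * Real.cos (e 2) - d * Real.sin (e 2)),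
        2 * e 0 * (1 + e 1) / ((1 - e 1) ^ 2 + e 0 ^ 2) + (d * Real.cos (e 2) + c * Real.sin (e 2)),
        (2 * e 0 * (1 - e 1) * Real.cos (e 2) + ((1 - e 1) ^ 2 - e 0 ^ 2) * Real.sin (e 2)) / ((1 - e 1) ^ 2 + e 0 ^ 2)] : Fin 3 → ℝ))
      (ContinuousLinearMap.pi fun i : Fin 3 => (![(4 : ℝ) • (ContinuousLinearMap.proj 1 : (Fin 3 → ℝ) →L[ℝ] ℝ) - d • (ContinuousLinearMap.proj 2 : (Fin 3 → ℝ) →L[ℝ] ℝ), (2 : ℝ) • (ContinuousLinearMap.proj 0 : (Fin 3 → ℝ) →L[ℝ] ℝ) + c • (ContinuousLinearMap.proj 2 : (Fin 3 → ℝ) →L[ℝ] ℝ), (2 : ℝ) • (ContinuousLinearMap.proj 0 : (Fin 3 → ℝ) →L[ℝ] ℝ) + (ContinuousLinearMap.proj 2 : (Fin 3 → ℝ) →L[ℝ] ℝ)] : Fin 3 → ((Fin 3 → ℝ) →L[ℝ] ℝ)) i)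
      0 := by
  have p0 : HasFDerivAt (fun e : Fin 3 → ℝ => e 0) (ContinuousLinearMap.proj 0 : (Fin 3 → ℝ) →L[ℝ] ℝ) (0 : Fin 3 → ℝ) := (ContinuousLinearMap.proj 0 : (Fin 3 → ℝ) →L[ℝ] ℝ).hasFDerivAt
  have p1 : HasFDerivAt (fun e : Fin 3 → ℝ => e 1) (ContinuousLinearMap.proj 1 : (Fin 3 → ℝ) →L[ℝ] ℝ) (0 : Fin 3 → ℝ) := (ContinuousLinearMap.proj 1 : (Fin 3 → ℝ) →L[ℝ] ℝ).hasFDerivAt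
  have p2 : HasFDerivAt (fun e : Fin 3 → ℝ => e 2) (ContinuousLinearMap.proj 2 : (Fin 3 → ℝ) →L[ℝ] ℝ) (0 : Fin 3 → ℝ) := (ContinuousLinearMap.proj 2 : (Fin 3 → ℝ) →L[ℝ] ℝ).hasFDerivAt
  -- trigonometric pieces at `e₂ = 0`
  have hcos : HasFDerivAt (fun e : Fin 3 → ℝ => Real.cos (e 2)) (0 : (Fin 3 → ℝ) →L[ℝ] ℝ) (0 : Fin 3 → ℝ) := by
    have h := (Real.hasDerivAt_cos ((0 : Fin 3 → ℝ) 2)).comp_hasFDerivAt (0 : Fin 3 → ℝ) p2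
    refine h.congr_fderiv ?_
    ext v; simp
  have hsin : HasFDerivAt (fun e : Fin 3 → ℝ => Real.sin (e 2)) (ContinuousLinearMap.proj 2 : (Fin 3 → ℝ) →L[ℝ] ℝ) (0 : Fin 3 → ℝ) := by
    have h := (Real.hasDerivAt_sin ((0 : Fin 3 → ℝ) 2)).comp_hasFDerivAt (0 : Fin 3 → ℝ) p2
    refine h.congr_fderiv ?_
    ext v; simp
  -- denominator
  have hD : HasFDerivAt (fun e : Fin 3 → ℝ => (1 - e 1) ^ 2 + e 0 ^ 2) (-(2 : ℝ) • (ContinuousLinearMap.proj 1 : (Fin 3 → ℝ) →L[ℝ] ℝ)) (0 : Fin 3 → ℝ) := by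
    have h : HasFDerivAt (fun e : Fin 3 → ℝ => (1 - e 1) * (1 - e 1) + e 0 * e 0) _ (0 : Fin 3 → ℝ) := ((p1.const_sub 1).mul (p1.const_sub 1)).add (p0.mul p0)
    have hfun : (fun e : Fin 3 → ℝ => (1 - e 1) * (1 - e 1) + e 0 * e 0) = fun e => (1 - e 1) ^ 2 + e 0 ^ 2 := by funext e; ring
    rw [hfun] at h
    refine h.congr_fderiv ?_
    ext v; simp; ring
  have hD1 : (fun e : Fin 3 → ℝ => (1 - e 1) ^ 2 + e 0 ^ 2) 0 = 1 := by simp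
  -- numerators
  have hu0 : HasFDerivAt (fun e : Fin 3 → ℝ => 2 * (1 - e 1 ^ 2)) (0 : (Fin 3 → ℝ) →L[ℝ] ℝ) (0 : Fin 3 → ℝ) := by
    have h : HasFDerivAt (fun e : Fin 3 → ℝ => 2 * (1 - e 1 * e 1)) _ (0 : Fin 3 → ℝ) := ((p1.mul p1).const_sub 1).const_mul 2
    have hfun : (fun e : Fin 3 → ℝ => 2 * (1 - e 1 * e 1)) = fun e => 2 * (1 - e 1 ^ 2) := by funext e; ring
    rw [hfun] at h
    refine h.congr_fderiv ?_
    ext v; simp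
  have hu1 : HasFDerivAt (fun e : Fin 3 → ℝ => 2 * e 0 * (1 + e 1)) ((2 : ℝ) • (ContinuousLinearMap.proj 0 : (Fin 3 → ℝ) →L[ℝ] ℝ)) (0 : Fin 3 → ℝ) := by
    have h : HasFDerivAt (fun e : Fin 3 → ℝ => 2 * e 0 * (1 + e 1)) _ (0 : Fin 3 → ℝ) := (p0.const_mul 2).mul (p1.const_add 1)
    refine h.congr_fderiv ?_
    ext v; simp
  have hu2 : HasFDerivAt (fun e : Fin 3 → ℝ => 2 * e 0 * (1 - e 1) * Real.cos (e 2) + ((1 - e 1) ^ 2 - e 0 ^ 2) * Real.sin (e 2))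
      ((2 : ℝ) • (ContinuousLinearMap.proj 0 : (Fin 3 → ℝ) →L[ℝ] ℝ) + (ContinuousLinearMap.proj 2 : (Fin 3 → ℝ) →L[ℝ] ℝ)) (0 : Fin 3 → ℝ) := by
    have h : HasFDerivAt (fun e : Fin 3 → ℝ => 2 * e 0 * (1 - e 1) * Real.cos (e 2) + ((1 - e 1) * (1 - e 1) - e 0 * e 0) * Real.sin (e 2)) _ (0 : Fin 3 → ℝ) :=
      (((p0.const_mul 2).mul (p1.const_sub 1)).mul hcos).add ((((p1.const_sub 1).mul (p1.const_sub 1)).sub (p0.mul p0)).mul hsin)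
    have hfun : (fun e : Fin 3 → ℝ => 2 * e 0 * (1 - e 1) * Real.cos (e 2) + ((1 - e 1) * (1 - e 1) - e 0 * e 0) * Real.sin (e 2)) =
        fun e => 2 * e 0 * (1 - e 1) * Real.cos (e 2) + ((1 - e 1) ^ 2 - e 0 ^ 2) * Real.sin (e 2) := by funext e; ring
    rw [hfun] at h
    refine h.congr_fderiv ?_
    ext v; simp
  -- trig sums
  have ht0 : HasFDerivAt (fun e : Fin 3 → ℝ => c * Real.cos (e 2) - d * Real.sin (e 2)) (-(d • (ContinuousLinearMap.proj 2 : (Fin 3 → ℝ) →L[ℝ] ℝ))) (0 : Fin 3 → ℝ) := by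
    have h : HasFDerivAt (fun e : Fin 3 → ℝ => c * Real.cos (e 2) - d * Real.sin (e 2)) _ (0 : Fin 3 → ℝ) := (hcos.const_mul c).sub (hsin.const_mul d)
    refine h.congr_fderiv ?_
    ext v; simp
  have ht1 : HasFDerivAt (fun e : Fin 3 → ℝ => d * Real.cos (e 2) + c * Real.sin (e 2)) (c • (ContinuousLinearMap.proj 2 : (Fin 3 → ℝ) →L[ℝ] ℝ)) (0 : Fin 3 → ℝ) := by
    have h : HasFDerivAt (fun e : Fin 3 → ℝ => d * Real.cos (e 2) + c * Real.sin (e 2)) _ (0 : Fin 3 → ℝ) := (hcos.const_mul d).add (hsin.const_mul c)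
    refine h.congr_fderiv ?_
    ext v; simp
  -- quotients and assembly
  have hq0 := (hasFDerivAt_div_of_eq_one hu0 hD hD1).add ht0
  have hq1 := (hasFDerivAt_div_of_eq_one hu1 hD hD1).add ht1
  have hq2 := hasFDerivAt_div_of_eq_one hu2 hD hD1
  rw [hasFDerivAt_pi']
  intro i
  fin_cases i
  · refine (hq0.congr_fderiv ?_)
    ext v; simp; ring
  · refine (hq1.congr_fderiv ?_)
    ext v; simp
  · refine (hq2.congr_fderiv ?_)
    ext v; simp

/-- The wall Jacobian as a continuous linear automorphism of `ℝ³` when `c ≠ 1` (determinant `−8(1 − c)`; inverse rows `(κ(y₁ − c y₂)∕2, y₀∕4 + dκ(y₂ − y₁)∕4, κ(y₂ − y₁))`, `κ = (1−c)⁻¹`).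
[cite: Dieudonne1960, Ch. VIII §2] -/
theorem exists_continuousLinearEquiv_wallChart {c : ℝ} (hc : c ≠ 1) (d : ℝ) :
    ∃ L : (Fin 3 → ℝ) ≃L[ℝ] (Fin 3 → ℝ), (L : (Fin 3 → ℝ) →L[ℝ] (Fin 3 → ℝ)) =
      ContinuousLinearMap.pi fun i : Fin 3 => (![(4 : ℝ) • (ContinuousLinearMap.proj 1 : (Fin 3 → ℝ) →L[ℝ] ℝ) - d • (ContinuousLinearMap.proj 2 : (Fin 3 → ℝ) →L[ℝ] ℝ), (2 : ℝ) • (ContinuousLinearMap.proj 0 : (Fin 3 → ℝ) →L[ℝ] ℝ) + c • (ContinuousLinearMap.proj 2 : (Fin 3 → ℝ) →L[ℝ] ℝ), (2 : ℝ) • (ContinuousLinearMap.proj 0 : (Fin 3 → ℝ) →L[ℝ] ℝ) + (ContinuousLinearMap.proj 2 : (Fin 3 → ℝ) →L[ℝ] ℝ)] : Fin 3 → ((Fin 3 → ℝ) →L[ℝ] ℝ)) i := by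
  have h1c : (1 - c) ≠ 0 := sub_ne_zero.2 (Ne.symm hc)
  refine ⟨ContinuousLinearEquiv.equivOfInverse
    (ContinuousLinearMap.pi fun i : Fin 3 => (![(4 : ℝ) • (ContinuousLinearMap.proj 1 : (Fin 3 → ℝ) →L[ℝ] ℝ) - d • (ContinuousLinearMap.proj 2 : (Fin 3 → ℝ) →L[ℝ] ℝ), (2 : ℝ) • (ContinuousLinearMap.proj 0 : (Fin 3 → ℝ) →L[ℝ] ℝ) + c • (ContinuousLinearMap.proj 2 : (Fin 3 → ℝ) →L[ℝ] ℝ), (2 : ℝ) • (ContinuousLinearMap.proj 0 : (Fin 3 → ℝ) →L[ℝ] ℝ) + (ContinuousLinearMap.proj 2 : (Fin 3 → ℝ) →L[ℝ] ℝ)] : Fin 3 → ((Fin 3 → ℝ) →L[ℝ] ℝ)) i)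
    (ContinuousLinearMap.pi fun i : Fin 3 => (![((1 - c)⁻¹ / 2) • ((ContinuousLinearMap.proj 1 : (Fin 3 → ℝ) →L[ℝ] ℝ) - c • (ContinuousLinearMap.proj 2 : (Fin 3 → ℝ) →L[ℝ] ℝ)),
        (4 : ℝ)⁻¹ • (ContinuousLinearMap.proj 0 : (Fin 3 → ℝ) →L[ℝ] ℝ) + (d * (1 - c)⁻¹ / 4) • ((ContinuousLinearMap.proj 2 : (Fin 3 → ℝ) →L[ℝ] ℝ) - (ContinuousLinearMap.proj 1 : (Fin 3 → ℝ) →L[ℝ] ℝ)),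
        (1 - c)⁻¹ • ((ContinuousLinearMap.proj 2 : (Fin 3 → ℝ) →L[ℝ] ℝ) - (ContinuousLinearMap.proj 1 : (Fin 3 → ℝ) →L[ℝ] ℝ))] : Fin 3 → ((Fin 3 → ℝ) →L[ℝ] ℝ)) i)
    (fun x => ?_) (fun y => ?_), rfl⟩
  · funext i
    fin_cases i <;> simp <;> field_simp <;> ring
  · funext i
    fin_cases i <;> simp <;> field_simp <;> ring

/-! ## §3 The wall local model -/

universe u

variable {P : Type u} [NormedAddCommGroup P] [NormedSpace ℝ P] [FiniteDimensional ℝ P]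
  {E : Type u} [NormedAddCommGroup E] [NormedSpace ℝ E] [CompleteSpace E]

/-- **THE WALL LOCAL MODEL — SMOOTH SWAP-SYMMETRIC GERMS AT A WALL POINT FACTOR THROUGH THE COMPLEX CLASS DATA.**  Base angles `(θ₀, θ₀, φ₀)` with `e^{iθ₀} ≠ e^{iφ₀}`; for every
`C^∞` map `g : (Fin 3 → ℝ) × P → E` invariant under the swap of the offsets `x₀ ↔ x₁` there are an open `W ⊆ ℂ³` containing the class data `S(0)`, a function `F` smooth on `W × P`, and
`δ > 0` with `S(x) ∈ W` and **`F (S x, z) = g (x, z)` for `‖x‖ < δ`**, where `S(x) = (Σ λ_k, Σ_{j<k} λ_jλ_k, Π λ_k)`, `λ = (e^{i(θ₀+x₀)}, e^{i(θ₀+x₁)}, e^{i(φ₀+x₂)})`.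
(★ Newton-`S₂` in the rational chart on the slots `0, 1`, §2's Jacobian and the smooth IFT ★ `exists_smooth_implicitFunction_of_contDiffAt`.) [cite: Glaeser1963Newton, Thm. II] [cite: Schwarz1975, Thm. 1]
[cite: Dieudonne1960, Ch. X §2] -/
theorem exists_contDiffOn_comp_wallClass_of_swap (θ₀ φ₀ : ℝ) (hne : Complex.exp ((θ₀ : ℂ) * I) ≠ Complex.exp ((φ₀ : ℂ) * I)) (g : (Fin 3 → ℝ) × P → E)
    (hg : ContDiff ℝ ∞ g) (hswap : ∀ (x : Fin 3 → ℝ) (z : P), g (x ∘ Equiv.swap (0 : Fin 3) 1, z) = g (x, z)) :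
    ∃ W : Set (ℂ × ℂ × ℂ), IsOpen W ∧ ((Complex.exp ((((θ₀ + 0 : ℝ)) : ℂ) * I) + Complex.exp ((((θ₀ + 0 : ℝ)) : ℂ) * I) + Complex.exp ((((φ₀ + 0 : ℝ)) : ℂ) * I),
          Complex.exp ((((θ₀ + 0 : ℝ)) : ℂ) * I) * Complex.exp ((((θ₀ + 0 : ℝ)) : ℂ) * I) + Complex.exp ((((θ₀ + 0 : ℝ)) : ℂ) * I) * Complex.exp ((((φ₀ + 0 : ℝ)) : ℂ) * I) + Complex.exp ((((θ₀ + 0 : ℝ)) : ℂ) * I) * Complex.exp ((((φ₀ + 0 : ℝ)) : ℂ) * I),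
          Complex.exp ((((θ₀ + 0 : ℝ)) : ℂ) * I) * Complex.exp ((((θ₀ + 0 : ℝ)) : ℂ) * I) * Complex.exp ((((φ₀ + 0 : ℝ)) : ℂ) * I)) : ℂ × ℂ × ℂ) ∈ W ∧
      ∃ F : (ℂ × ℂ × ℂ) × P → E, ContDiffOn ℝ ∞ F (W ×ˢ Set.univ) ∧ ∃ δ > (0 : ℝ), ∀ x : Fin 3 → ℝ, ‖x‖ < δ → ∀ z : P,
        ((Complex.exp ((((θ₀ + x 0 : ℝ)) : ℂ) * I) + Complex.exp ((((θ₀ + x 1 : ℝ)) : ℂ) * I) + Complex.exp ((((φ₀ + x 2 : ℝ)) : ℂ) * I),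
          Complex.exp ((((θ₀ + x 0 : ℝ)) : ℂ) * I) * Complex.exp ((((θ₀ + x 1 : ℝ)) : ℂ) * I) + Complex.exp ((((θ₀ + x 0 : ℝ)) : ℂ) * I) * Complex.exp ((((φ₀ + x 2 : ℝ)) : ℂ) * I) + Complex.exp ((((θ₀ + x 1 : ℝ)) : ℂ) * I) * Complex.exp ((((φ₀ + x 2 : ℝ)) : ℂ) * I),
          Complex.exp ((((θ₀ + x 0 : ℝ)) : ℂ) * I) * Complex.exp ((((θ₀ + x 1 : ℝ)) : ℂ) * I) * Complex.exp ((((φ₀ + x 2 : ℝ)) : ℂ) * I)) : ℂ × ℂ × ℂ) ∈ W ∧ F (((Complex.exp ((((θ₀ + x 0 : ℝ)) : ℂ) * I) + Complex.exp ((((θ₀ + x 1 : ℝ)) : ℂ) * I) + Complex.exp ((((φ₀ + x 2 : ℝ)) : ℂ) * I),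
          Complex.exp ((((θ₀ + x 0 : ℝ)) : ℂ) * I) * Complex.exp ((((θ₀ + x 1 : ℝ)) : ℂ) * I) + Complex.exp ((((θ₀ + x 0 : ℝ)) : ℂ) * I) * Complex.exp ((((φ₀ + x 2 : ℝ)) : ℂ) * I) + Complex.exp ((((θ₀ + x 1 : ℝ)) : ℂ) * I) * Complex.exp ((((φ₀ + x 2 : ℝ)) : ℂ) * I),
          Complex.exp ((((θ₀ + x 0 : ℝ)) : ℂ) * I) * Complex.exp ((((θ₀ + x 1 : ℝ)) : ℂ) * I) * Complex.exp ((((φ₀ + x 2 : ℝ)) : ℂ) * I)) : ℂ × ℂ × ℂ), z) = g (x, z) := by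
  set ζ : ℂ := Complex.exp ((θ₀ : ℂ) * I) with hζ
  set ξ : ℂ := Complex.exp ((φ₀ : ℂ) * I) with hξ
  set w : ℂ := ξ * (starRingEnd ℂ) ζ with hw
  set S : (Fin 3 → ℝ) → ℂ × ℂ × ℂ := fun x =>
    (Complex.exp ((((θ₀ + x 0 : ℝ)) : ℂ) * I) + Complex.exp ((((θ₀ + x 1 : ℝ)) : ℂ) * I) + Complex.exp ((((φ₀ + x 2 : ℝ)) : ℂ) * I),
      Complex.exp ((((θ₀ + x 0 : ℝ)) : ℂ) * I) * Complex.exp ((((θ₀ + x 1 : ℝ)) : ℂ) * I) +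
          Complex.exp ((((θ₀ + x 0 : ℝ)) : ℂ) * I) * Complex.exp ((((φ₀ + x 2 : ℝ)) : ℂ) * I) +
        Complex.exp ((((θ₀ + x 1 : ℝ)) : ℂ) * I) * Complex.exp ((((φ₀ + x 2 : ℝ)) : ℂ) * I),
      Complex.exp ((((θ₀ + x 0 : ℝ)) : ℂ) * I) * Complex.exp ((((θ₀ + x 1 : ℝ)) : ℂ) * I) * Complex.exp ((((φ₀ + x 2 : ℝ)) : ℂ) * I)) with hS
  set proj : ℂ × ℂ × ℂ → (Fin 3 → ℝ) := fun σ => ![(σ.1 * (starRingEnd ℂ) ζ).re, (σ.1 * (starRingEnd ℂ) ζ).im, (σ.2.2 * ((starRingEnd ℂ) ζ ^ 2 * (starRingEnd ℂ) ξ)).im] with hproj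
  set c : ℝ := w.re with hc
  set d : ℝ := w.im with hd
  set ψ : (Fin 3 → ℝ) → (Fin 3 → ℝ) := fun e => ![2 * (1 - e 1 ^ 2) / ((1 - e 1) ^ 2 + e 0 ^ 2) + (c * Real.cos (e 2) - d * Real.sin (e 2)),
        2 * e 0 * (1 + e 1) / ((1 - e 1) ^ 2 + e 0 ^ 2) + (d * Real.cos (e 2) + c * Real.sin (e 2)),
        (2 * e 0 * (1 - e 1) * Real.cos (e 2) + ((1 - e 1) ^ 2 - e 0 ^ 2) * Real.sin (e 2)) / ((1 - e 1) ^ 2 + e 0 ^ 2)] with hψ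
  -- the chart in the coordinates `(t₀, t₁, y)`: `ch q := S (2 arctan t₀, 2 arctan t₁, y)` and its invariants `inv q := (t₀ + t₁, t₀ t₁, y)`
  set inv : (Fin 3 → ℝ) → (Fin 3 → ℝ) := fun q => ![q 0 + q 1, q 0 * q 1, q 2] with hinv
  -- (0) `c ≠ 1`
  have hζu : (starRingEnd ℂ) ζ * ζ = 1 := by rw [hζ]; exact conj_cexp_mul_cexp θ₀
  have hζ0 : ζ ≠ 0 := by rw [hζ]; exact Complex.exp_ne_zero _
  have hw1 : w ≠ 1 := by
    intro h
    apply hne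
    -- `ξ ζ̄ = 1 ⇒ ξ = ζ`
    have : ξ * ((starRingEnd ℂ) ζ * ζ) = ζ := by rw [← mul_assoc, ← hw, h, one_mul]
    rw [hζu, mul_one] at this
    exact this.symm
  have hwn : ‖w‖ = 1 := by
    rw [hw, norm_mul, hξ, Complex.norm_exp_ofReal_mul_I, one_mul, Complex.norm_conj, hζ, Complex.norm_exp_ofReal_mul_I]
  have hc1 : c ≠ 1 := re_ne_one_of_ne_one_of_norm_eq_one hwn hw1
  -- (1) the KEY identity `proj (S (2 arctan t₀, 2 arctan t₁, y)) = ψ (t₀ + t₁, t₀ t₁, y)`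
  have hconjζ : ∀ x : ℝ, Complex.exp ((((θ₀ + x : ℝ)) : ℂ) * I) * (starRingEnd ℂ) ζ = Complex.exp ((x : ℂ) * I) := by
    intro x
    rw [cexp_add_mul_I, hζ, mul_comm (Complex.exp _) (Complex.exp _), mul_assoc, mul_comm (Complex.exp ((θ₀ : ℂ) * I)), conj_cexp_mul_cexp, mul_one]
  have hconjξ : ∀ x : ℝ, Complex.exp ((((φ₀ + x : ℝ)) : ℂ) * I) * (starRingEnd ℂ) ξ = Complex.exp ((x : ℂ) * I) := by
    intro x
    rw [cexp_add_mul_I, hξ, mul_comm (Complex.exp _) (Complex.exp _), mul_assoc, mul_comm (Complex.exp ((φ₀ : ℂ) * I)), conj_cexp_mul_cexp, mul_one]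
  have hthird : ∀ x : ℝ, Complex.exp ((((φ₀ + x : ℝ)) : ℂ) * I) * (starRingEnd ℂ) ζ = w * Complex.exp ((x : ℂ) * I) := by
    intro x
    rw [cexp_add_mul_I, hw, hξ]; ring
  have hkey : ∀ q : Fin 3 → ℝ, proj (S ![2 * Real.arctan (q 0), 2 * Real.arctan (q 1), q 2]) = ψ (inv q) := by
    intro q
    have hk0 : Complex.exp ((((θ₀ + 2 * Real.arctan (q 0) : ℝ)) : ℂ) * I) * (starRingEnd ℂ) ζ =
        (((1 - q 0 ^ 2) / (1 + q 0 ^ 2) : ℝ) : ℂ) + ((((2 * q 0 / (1 + q 0 ^ 2) : ℝ)) : ℂ)) * I := by rw [hconjζ, cexp_two_mul_arctan_mul_I]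
    have hk1 : Complex.exp ((((θ₀ + 2 * Real.arctan (q 1) : ℝ)) : ℂ) * I) * (starRingEnd ℂ) ζ =
        (((1 - q 1 ^ 2) / (1 + q 1 ^ 2) : ℝ) : ℂ) + ((((2 * q 1 / (1 + q 1 ^ 2) : ℝ)) : ℂ)) * I := by rw [hconjζ, cexp_two_mul_arctan_mul_I]
    have hk2 : Complex.exp ((((φ₀ + q 2 : ℝ)) : ℂ) * I) * (starRingEnd ℂ) ξ = Complex.exp (((q 2 : ℝ) : ℂ) * I) := hconjξ _
    -- first functional
    have h1 : (S ![2 * Real.arctan (q 0), 2 * Real.arctan (q 1), q 2]).1 * (starRingEnd ℂ) ζ =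
        ((((1 - q 0 ^ 2) / (1 + q 0 ^ 2) : ℝ) : ℂ) + ((((2 * q 0 / (1 + q 0 ^ 2) : ℝ)) : ℂ)) * I) +
        ((((1 - q 1 ^ 2) / (1 + q 1 ^ 2) : ℝ) : ℂ) + ((((2 * q 1 / (1 + q 1 ^ 2) : ℝ)) : ℂ)) * I) + w * Complex.exp (((q 2 : ℝ) : ℂ) * I) := by
      simp only [hS, Matrix.cons_val_zero, Matrix.cons_val_one, Matrix.cons_val_two, Matrix.head_cons, Matrix.tail_cons, add_mul, hk0, hk1, hthird]
    -- third functional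
    have h3 : (S ![2 * Real.arctan (q 0), 2 * Real.arctan (q 1), q 2]).2.2 * ((starRingEnd ℂ) ζ ^ 2 * (starRingEnd ℂ) ξ) =
        (((((1 - q 0 ^ 2) / (1 + q 0 ^ 2) : ℝ) : ℂ) + ((((2 * q 0 / (1 + q 0 ^ 2) : ℝ)) : ℂ)) * I) *
        ((((1 - q 1 ^ 2) / (1 + q 1 ^ 2) : ℝ) : ℂ) + ((((2 * q 1 / (1 + q 1 ^ 2) : ℝ)) : ℂ)) * I)) * Complex.exp (((q 2 : ℝ) : ℂ) * I) := by
      rw [← hk0, ← hk1, ← hk2]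
      simp only [hS, Matrix.cons_val_zero, Matrix.cons_val_one, Matrix.cons_val_two, Matrix.head_cons, Matrix.tail_cons]
      ring
    have hre : ∀ a b : ℝ, (((a : ℂ)) + ((b : ℂ)) * I).re = a := by intro a b; simp
    have him : ∀ a b : ℝ, (((a : ℂ)) + ((b : ℂ)) * I).im = b := by intro a b; simp
    have hA : ((S ![2 * Real.arctan (q 0), 2 * Real.arctan (q 1), q 2]).1 * (starRingEnd ℂ) ζ).re =
        2 * (1 - (q 0 * q 1) ^ 2) / ((1 - q 0 * q 1) ^ 2 + (q 0 + q 1) ^ 2) + (c * Real.cos (q 2) - d * Real.sin (q 2)) := by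
      rw [h1, Complex.add_re, Complex.add_re, hre, hre, sum_cos_chart_two_eq, re_mul_cexp_mul_I]
    have hB : ((S ![2 * Real.arctan (q 0), 2 * Real.arctan (q 1), q 2]).1 * (starRingEnd ℂ) ζ).im =
        2 * (q 0 + q 1) * (1 + q 0 * q 1) / ((1 - q 0 * q 1) ^ 2 + (q 0 + q 1) ^ 2) + (d * Real.cos (q 2) + c * Real.sin (q 2)) := by
      rw [h1, Complex.add_im, Complex.add_im, him, him, sum_sin_chart_two_eq, im_mul_cexp_mul_I]
    have hC : ((S ![2 * Real.arctan (q 0), 2 * Real.arctan (q 1), q 2]).2.2 * ((starRingEnd ℂ) ζ ^ 2 * (starRingEnd ℂ) ξ)).im =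
        (2 * (q 0 + q 1) * (1 - q 0 * q 1) * Real.cos (q 2) + ((1 - q 0 * q 1) ^ 2 - (q 0 + q 1) ^ 2) * Real.sin (q 2)) / ((1 - q 0 * q 1) ^ 2 + (q 0 + q 1) ^ 2) := by
      rw [h3, im_mul_cexp_mul_I, prod_chart_two_re, prod_chart_two_im]
      have hD : (1 - q 0 * q 1) ^ 2 + (q 0 + q 1) ^ 2 ≠ 0 := by
        have : (1 - q 0 * q 1) ^ 2 + (q 0 + q 1) ^ 2 = (1 + q 0 ^ 2) * (1 + q 1 ^ 2) := by ring
        rw [this]; positivity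
      field_simp
    simp only [hproj, hψ, hinv, Matrix.cons_val_zero, Matrix.cons_val_one, Matrix.cons_val_two, Matrix.head_cons, Matrix.tail_cons, hA, hB, hC]
  -- (2) smoothness of `proj`, `inv`, `ψ`
  have hproj_s : ContDiff ℝ ∞ proj := by
    refine contDiff_pi.2 fun i => ?_
    fin_cases i
    · exact Complex.reCLM.contDiff.comp (contDiff_fst.mul contDiff_const)
    · exact Complex.imCLM.contDiff.comp (contDiff_fst.mul contDiff_const)
    · exact Complex.imCLM.contDiff.comp ((contDiff_snd.comp contDiff_snd).mul contDiff_const)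
  have hinv_s : ContDiff ℝ ∞ inv := by
    refine contDiff_pi.2 fun i => ?_
    fin_cases i
    · exact (contDiff_apply ℝ ℝ 0).add (contDiff_apply ℝ ℝ 1)
    · exact (contDiff_apply ℝ ℝ 0).mul (contDiff_apply ℝ ℝ 1)
    · exact contDiff_apply ℝ ℝ 2
  set Dset : Set (Fin 3 → ℝ) := {e | (1 - e 1) ^ 2 + e 0 ^ 2 ≠ 0} with hDset
  have hDc : Continuous fun e : Fin 3 → ℝ => (1 - e 1) ^ 2 + e 0 ^ 2 := by fun_prop
  have hDopen : IsOpen Dset := isOpen_ne_fun hDc continuous_const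
  have hD0 : (0 : Fin 3 → ℝ) ∈ Dset := by simp [hDset]
  have hψ_s : ∀ e ∈ Dset, ContDiffAt ℝ ∞ ψ e := by
    intro e he
    have hd : ContDiffAt ℝ ∞ (fun e : Fin 3 → ℝ => (1 - e 1) ^ 2 + e 0 ^ 2) e := by fun_prop
    have hcos : ContDiffAt ℝ ∞ (fun e : Fin 3 → ℝ => Real.cos (e 2)) e := (Real.contDiff_cos.comp (contDiff_apply ℝ ℝ 2)).contDiffAt
    have hsin : ContDiffAt ℝ ∞ (fun e : Fin 3 → ℝ => Real.sin (e 2)) e := (Real.contDiff_sin.comp (contDiff_apply ℝ ℝ 2)).contDiffAt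
    refine contDiffAt_pi.2 fun i => ?_
    fin_cases i
    · exact (ContDiffAt.div (by fun_prop) hd he).add ((contDiffAt_const.mul hcos).sub (contDiffAt_const.mul hsin))
    · exact (ContDiffAt.div (by fun_prop) hd he).add ((contDiffAt_const.mul hcos).add (contDiffAt_const.mul hsin))
    · exact ContDiffAt.div (((by fun_prop : ContDiffAt ℝ ∞ (fun e : Fin 3 → ℝ => 2 * e 0 * (1 - e 1)) e).mul hcos).add
        ((by fun_prop : ContDiffAt ℝ ∞ (fun e : Fin 3 → ℝ => (1 - e 1) ^ 2 - e 0 ^ 2) e).mul hsin)) hd he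
  -- (3) the implicit function theorem for `G (y, e) := ψ e − y`
  obtain ⟨L, hL⟩ := exists_continuousLinearEquiv_wallChart hc1 d
  have hψd : HasFDerivAt ψ (L : (Fin 3 → ℝ) →L[ℝ] (Fin 3 → ℝ)) 0 := by rw [hL]; exact hasFDerivAt_wallChart_zero c d
  set G : (Fin 3 → ℝ) × (Fin 3 → ℝ) → (Fin 3 → ℝ) := fun q => ψ q.2 - q.1 with hG
  have hGs : ∀ q ∈ (Set.univ : Set (Fin 3 → ℝ)) ×ˢ Dset, ContDiffAt ℝ ∞ G q := by
    rintro ⟨y, e⟩ ⟨-, he⟩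
    exact ((hψ_s e he).comp (y, e) contDiffAt_snd).sub contDiffAt_fst
  have hG0 : G (ψ 0, 0) = 0 := by simp [hG]
  have hGd : (fderiv ℝ G (ψ 0, 0)).comp (ContinuousLinearMap.inr ℝ (Fin 3 → ℝ) (Fin 3 → ℝ)) = (L : (Fin 3 → ℝ) →L[ℝ] (Fin 3 → ℝ)) := by
    have hsnd : HasFDerivAt (fun q : (Fin 3 → ℝ) × (Fin 3 → ℝ) => q.2) (ContinuousLinearMap.snd ℝ (Fin 3 → ℝ) (Fin 3 → ℝ)) (ψ 0, (0 : Fin 3 → ℝ)) :=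
      hasFDerivAt_snd
    have hfst : HasFDerivAt (fun q : (Fin 3 → ℝ) × (Fin 3 → ℝ) => q.1) (ContinuousLinearMap.fst ℝ (Fin 3 → ℝ) (Fin 3 → ℝ)) (ψ 0, (0 : Fin 3 → ℝ)) :=
      hasFDerivAt_fst
    have hψd' : HasFDerivAt ψ (L : (Fin 3 → ℝ) →L[ℝ] (Fin 3 → ℝ)) ((ψ 0, (0 : Fin 3 → ℝ)) : (Fin 3 → ℝ) × (Fin 3 → ℝ)).2 := hψd
    have h : HasFDerivAt G ((L : (Fin 3 → ℝ) →L[ℝ] (Fin 3 → ℝ)).comp (ContinuousLinearMap.snd ℝ (Fin 3 → ℝ) (Fin 3 → ℝ)) -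
        ContinuousLinearMap.fst ℝ (Fin 3 → ℝ) (Fin 3 → ℝ)) (ψ 0, 0) :=
      (HasFDerivAt.comp ((ψ 0, (0 : Fin 3 → ℝ)) : (Fin 3 → ℝ) × (Fin 3 → ℝ)) hψd' hsnd).sub hfst
    rw [h.fderiv]
    ext v i
    simp
  obtain ⟨ρ₁, hρ₁, ρ₂, hρ₂, χ, hχs, hχ0, hχball, hχzero, hχuniq⟩ :=
    exists_smooth_implicitFunction_of_contDiffAt G (ψ 0) 0 ((Set.univ : Set (Fin 3 → ℝ)) ×ˢ Dset) (isOpen_univ.prod hDopen) ⟨mem_univ _, hD0⟩ hGs hG0 L hGd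
  -- (4) ★ Newton-`S₂` for the germ in the chart, parameters `(y, z)`
  set gt : (Fin 2 → ℝ) × (ℝ × P) → E := fun q => g (![2 * Real.arctan (q.1 0), 2 * Real.arctan (q.1 1), q.2.1], q.2.2) with hgt
  have hgts : ContDiff ℝ ∞ gt := by
    refine hg.comp (ContDiff.prodMk ?_ (contDiff_snd.comp contDiff_snd))
    refine contDiff_pi.2 fun k => ?_
    fin_cases k
    · exact contDiff_const.mul (Real.contDiff_arctan.comp ((contDiff_apply ℝ ℝ 0).comp contDiff_fst))
    · exact contDiff_const.mul (Real.contDiff_arctan.comp ((contDiff_apply ℝ ℝ 1).comp contDiff_fst))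
    · exact contDiff_fst.comp contDiff_snd
  have hgtswap : ∀ (u : Fin 2 → ℝ) (yz : ℝ × P), gt (![u 1, u 0], yz) = gt (u, yz) := by
    intro u yz
    simp only [hgt, Matrix.cons_val_zero, Matrix.cons_val_one]
    have hperm : (![2 * Real.arctan (u 1), 2 * Real.arctan (u 0), yz.1] : Fin 3 → ℝ) = (![2 * Real.arctan (u 0), 2 * Real.arctan (u 1), yz.1] : Fin 3 → ℝ) ∘ Equiv.swap (0 : Fin 3) 1 := by
      funext k; fin_cases k <;> simp [Equiv.swap_apply_of_ne_of_ne]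
    rw [hperm, hswap]
  obtain ⟨G2, hG2s, hG2⟩ := exists_contDiff_comp_esymm_two_of_swap gt hgts hgtswap
  -- (5) `W`, `F`, `δ`
  refine ⟨proj ⁻¹' Metric.ball (ψ 0) ρ₁, Metric.isOpen_ball.preimage hproj_s.continuous, ?_,
    fun q => G2 (![χ (proj q.1) 0, χ (proj q.1) 1], (χ (proj q.1) 2, q.2)), ?_, ?_⟩
  · -- the wall point: `S 0 = S (2 arctan 0, 2 arctan 0, 0)` and `proj (S …) = ψ (inv 0) = ψ 0`
    have h := hkey 0
    have e0 : inv 0 = 0 := by funext i; fin_cases i <;> simp [hinv]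
    have harc : (![2 * Real.arctan ((0 : Fin 3 → ℝ) 0), 2 * Real.arctan ((0 : Fin 3 → ℝ) 1), (0 : Fin 3 → ℝ) 2] : Fin 3 → ℝ) = fun _ => 0 := by
      funext k; fin_cases k <;> simp
    rw [harc, e0] at h
    show proj (S fun _ => 0) ∈ Metric.ball (ψ 0) ρ₁
    rw [h]
    exact Metric.mem_ball_self hρ₁
  · have hχc : ContDiffOn ℝ ∞ (fun q : (ℂ × ℂ × ℂ) × P => χ (proj q.1)) ((proj ⁻¹' Metric.ball (ψ 0) ρ₁) ×ˢ Set.univ) :=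
      hχs.comp (hproj_s.comp contDiff_fst).contDiffOn fun q hq => (Set.mem_prod.1 hq).1
    have hχk : ∀ k : Fin 3, ContDiffOn ℝ ∞ (fun q : (ℂ × ℂ × ℂ) × P => χ (proj q.1) k) ((proj ⁻¹' Metric.ball (ψ 0) ρ₁) ×ˢ Set.univ) :=
      fun k => (contDiff_apply ℝ ℝ k).comp_contDiffOn hχc
    refine hG2s.comp_contDiffOn (ContDiffOn.prodMk ?_ (ContDiffOn.prodMk (hχk 2) contDiff_snd.contDiffOn))
    refine contDiffOn_pi.2 fun k => ?_
    fin_cases k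
    · exact hχk 0
    · exact hχk 1
  · -- `δ`: `|x_k| < π`, `(tan (x₀∕2), tan (x₁∕2), x₂)` close to `0`
    set τ : (Fin 3 → ℝ) → (Fin 3 → ℝ) := fun x => ![Real.tan (x 0 / 2), Real.tan (x 1 / 2), x 2] with hτ
    have hτc : ContinuousAt τ 0 := by
      have h0 : Real.cos (0 : ℝ) ≠ 0 := by simp
      have htan : ∀ k : Fin 3, ContinuousAt (fun x : Fin 3 → ℝ => Real.tan (x k / 2)) 0 := by
        intro k
        have hinc : Continuous (fun x : Fin 3 → ℝ => x k / 2) := by fun_prop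
        have ht : ContinuousAt Real.tan ((fun x : Fin 3 → ℝ => x k / 2) 0) := by
          have e : (fun x : Fin 3 → ℝ => x k / 2) 0 = 0 := by simp
          rw [e]; exact (Real.hasDerivAt_tan h0).continuousAt
        exact ContinuousAt.comp (g := Real.tan) (f := fun x : Fin 3 → ℝ => x k / 2) ht hinc.continuousAt
      refine continuousAt_pi.2 fun k => ?_
      fin_cases k
      · exact htan 0
      · exact htan 1
      · exact (continuous_apply 2).continuousAt
    have hτ0 : τ 0 = 0 := by funext k; fin_cases k <;> simp [hτ]
    have hi0 : inv (τ 0) = 0 := by rw [hτ0]; funext i; fin_cases i <;> simp [hinv]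
    have hcont2 : ContinuousAt (fun x => inv (τ x)) 0 := ContinuousAt.comp (g := inv) (f := τ) (x := (0 : Fin 3 → ℝ)) hinv_s.continuous.continuousAt hτc
    have hcont1 : ContinuousAt (fun x => ψ (inv (τ x))) 0 := by
      have h := (hψ_s 0 hD0).continuousAt
      rw [← hi0] at h
      exact ContinuousAt.comp (g := ψ) (f := fun x => inv (τ x)) (x := (0 : Fin 3 → ℝ)) h hcont2
    have hm1 : (fun x => ψ (inv (τ x))) ⁻¹' Metric.ball (ψ 0) ρ₁ ∈ 𝓝 (0 : Fin 3 → ℝ) :=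
      hcont1.preimage_mem_nhds (by rw [hi0]; exact Metric.isOpen_ball.mem_nhds (Metric.mem_ball_self hρ₁))
    have hm2 : (fun x => inv (τ x)) ⁻¹' Metric.ball 0 ρ₂ ∈ 𝓝 (0 : Fin 3 → ℝ) :=
      hcont2.preimage_mem_nhds (by rw [hi0]; exact Metric.isOpen_ball.mem_nhds (Metric.mem_ball_self hρ₂))
    obtain ⟨δ₁, hδ₁, hball⟩ := Metric.mem_nhds_iff.1 (Filter.inter_mem hm1 hm2)
    refine ⟨min δ₁ Real.pi, lt_min hδ₁ Real.pi_pos, fun x hx z => ?_⟩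
    have hx₁ : ‖x‖ < δ₁ := lt_of_lt_of_le hx (min_le_left _ _)
    have hxπ : ‖x‖ < Real.pi := lt_of_lt_of_le hx (min_le_right _ _)
    obtain ⟨h1, h2⟩ := hball (by rwa [Metric.mem_ball, dist_zero_right] : x ∈ Metric.ball (0 : Fin 3 → ℝ) δ₁)
    -- `2 arctan (tan (x_k∕2)) = x_k`
    have hk : ∀ k : Fin 3, 2 * Real.arctan (Real.tan (x k / 2)) = x k := by
      intro k
      have hk : |x k| < Real.pi := lt_of_le_of_lt (by simpa [Real.norm_eq_abs] using norm_le_pi_norm x k) hxπ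
      have ha : -(Real.pi / 2) < x k / 2 := by have := (abs_lt.1 hk).1; linarith
      have hb : x k / 2 < Real.pi / 2 := by have := (abs_lt.1 hk).2; linarith
      rw [Real.arctan_tan ha hb]; ring
    have harc : (![2 * Real.arctan (τ x 0), 2 * Real.arctan (τ x 1), τ x 2] : Fin 3 → ℝ) = x := by
      funext k; fin_cases k <;> simp [hτ, hk]
    have hSx : S ![2 * Real.arctan (τ x 0), 2 * Real.arctan (τ x 1), τ x 2] = S x := by rw [harc]
    have hpS : proj (S x) = ψ (inv (τ x)) := by rw [← hSx]; exact hkey (τ x)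
    refine ⟨?_, ?_⟩
    · show proj (S x) ∈ Metric.ball (ψ 0) ρ₁
      rw [hpS]; exact h1
    · -- `χ (proj (S x)) = inv (τ x)`, then Newton
      have hχe : χ (proj (S x)) = inv (τ x) := by
        rw [hpS]; exact (hχuniq (ψ (inv (τ x))) h1 (inv (τ x)) h2 (by simp [hG])).symm
      show G2 (![χ (proj (S x)) 0, χ (proj (S x)) 1], (χ (proj (S x)) 2, z)) = g (x, z)
      rw [hχe]
      have hg2 := hG2 (![τ x 0, τ x 1]) (τ x 2, z)
      simp only [Matrix.cons_val_zero, Matrix.cons_val_one] at hg2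
      simp only [hinv, Matrix.cons_val_zero, Matrix.cons_val_one, Matrix.cons_val_two, Matrix.head_cons, Matrix.tail_cons]
      rw [← hg2]
      simp only [hgt, Matrix.cons_val_zero, Matrix.cons_val_one, harc]

end Literature.Analysis.Calculus

end
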